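import Summits.NavierStokesRegularity.FluidComputer.LevelReynoldsFloor
import Summits.NavierStokesRegularity.FluidComputer.LambdaFrontier
import Literature.Analysis.FluidPDE.DissipationWavenumber
import HarnessLib

/-!
# Fluid computer — TERMINAL-WINDOW FLOORS: a blow-up re-saturates infinitely many levels in every window `(t₀, T)` ("no one-shot focusing")

HONEST FRAMING (cell `pub-fluidc`, verbatim): *low prior, high value-of-information experiment on Tao's
machine paradigm; NOT a claim that NS blows up.* This file is on the THEOREM side of the cell (floors every
cascade design must respect); nothing here is evidence of blow-up.

Context (HOME/PLAN.md §8a–§8b, RULINGS R33/R34 of the cell LEAD, 2026-08-23). The certified BREAK POINT of the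
cell's amplitude rung is ONE designed field crossing the level-Reynolds floor `r ≥ 1` at level one (`r = 1.61` at
`λ = 2`) and then falling below the classical null at level two (`r₂ = 0.20 ≤ r_null`): a ONE-SHOT FOCUSING reading;
the standing question handed to any successor rung is "`r_phys ≥ 1`, or TWO CONSECUTIVE LEVELS". This file types the
theorem-side reason such a one-shot event is not what a blow-up does. The floor theorem of the tree,
`LevelReynoldsFloor.dyadic_floor` (Cheskidov–Shvydkoy 2010, Lemma 3.2 [CheskidovShvydkoy2010], DISCHARGED in the
tree, composed with the tree's continuation step), bounds `limsup_j sup_{t ∈ (0,T)} 2^{-j}‖Δ̇_j u(t)‖_∞` from below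
by `c ν` — a supremum over the WHOLE life span, which a single early event could in principle exhaust. Restarting
the solution at a good Leray–Hopf time inside any terminal window (the tree's
`IsLerayHopfOn.exists_isLerayHopfOn_restart_Ioo`, Robinson–Rodrigo–Sadowski 2016, proof of Lemma 8.4, and
`IsMaximalSmoothSolution.translate_zero`, Beale–Kato–Majda 1984 §1) localises every floor to `(t₀, T)`:

* `exists_restart` — the restart package: for every `t₀ ∈ [0, T)` some `s ∈ (t₀, T)` restarts `(u, p)` as a
  maximal smooth solution with lifespan `T - s`, Leray–Hopf from `u s`, with the translated slice distributions.
* `dyadic_floor_window` (**L5**) — for EVERY `t₀ ∈ [0, T)`: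
  `c ν ≤ limsup_{j → ∞} sup_{t ∈ (t₀,T)} 2^{-j} ‖Δ̇_j U(t)‖_∞` (same absolute `c` as `dyadic_floor`).
* `level_amplitude_frequently_gt_window` / `level_supnorm_frequently_gt_window` (**L5′**) — for every `b < c`
  and every `t₀ < T`, infinitely many levels `j` carry a time `t ∈ (t₀, T)` with `2^{-j}‖Δ̇_j U(t)‖_∞ > b ν`
  (resp. `‖Δ̇_j U(t)‖_∞ > b ν 2^j`).
* `exists_saturated_after` (**L6**, NO ONE-SHOT) — for every `b < c`, `t₀ < T` and `J`, some level `j ≥ J` is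
  SATURATED (`Literature.Analysis.FluidPDE.IsSaturatedLevel b ν (u t) j`, the Cheskidov–Shvydkoy 2014 predicate
  `‖Δ̇_j u(t)‖_∞ ≥ b ν 2^j` [CheskidovShvydkoy2011, §3]) at some time `t ∈ (t₀, T)`: saturation recurs at
  arbitrarily high levels arbitrarily close to the blow-up time.
* `iSup_dissipationWavenumber_window_eq_top` (**L7**) — in the language of the dissipation wavenumber
  `Λ_b(t) = Literature.Analysis.FluidPDE.dissipationWavenumber b ν (u t)` (top saturated wavenumber): for every
  `b < c` and `t₀ < T`, `sup_{t ∈ (t₀,T)} Λ_b(t) = ∞` — `Λ` is unbounded on every terminal window (the tree's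
  `regular_of_dissipationWavenumber_le` is the window `(0, T)`; Cheskidov–Shvydkoy 2014 §4: "`Λ ∈ L^∞(0,T)`" ⇒ regular).
* `not_isSaturatedLevel_of_lt` + `exists_quiet_then_saturated` (**L8**, LADDER ORDER) — the Bernstein step of
  Cheskidov–Shvydkoy 2014, Lemma 4.1 (tree: `exists_two_pow_mul_le_dissipation_of_saturated`,
  `(bν)² 2^j ≤ C ∫|∇u(t)|²` at a saturated level) makes every level above `log₂ (C D/(bν)²)` QUIET on any initial
  segment `[0, t₀]` along which `∫ |∇u(t)|² ≤ D`; with L6: given such `H¹`-control up to `t₀`, there are levels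
  (infinitely many, arbitrarily high) that are quiet throughout `[0, t₀]` and saturated somewhere in `(t₀, T)` —
  the saturation front migrates to ever finer levels as `t ↑ T`. In cascade words: a realised blow-up passes the
  floor at infinitely many levels IN ORDER OF TIME, never by a single focusing event followed by decay.

0 sorry; axioms ⊆ {propext, Classical.choice, Quot.sound}; no named fact is introduced (inputs: the tree theorems
`LevelReynoldsFloor.dyadic_floor` / `level_supnorm_frequently_gt`, `IsLerayHopfOn.exists_isLerayHopfOn_restart_Ioo`,
`IsMaximalSmoothSolution.translate_zero`, `isSaturatedLevel_iff_le_lpBlockWeight`,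
`two_pow_le_dissipationWavenumber`, `exists_two_pow_mul_le_dissipation_of_saturated` — all proved).

## References

* A. Cheskidov, R. Shvydkoy, *The regularity of weak solutions of the 3D Navier–Stokes equations in
  `B^{-1}_{∞,∞}`*, Arch. Ration. Mech. Anal. 195 (2010) 159–169, Lemma 3.2. [CheskidovShvydkoy2010]
* A. Cheskidov, R. Shvydkoy, *A unified approach to regularity problems for the 3D Navier–Stokes and Euler
  equations: the use of Kolmogorov's dissipation range*, J. Math. Fluid Mech. 16 (2014) 263–273, §3 (definition
  of `Λ`), Lemma 4.1, §4. [CheskidovShvydkoy2011]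
* J. C. Robinson, J. L. Rodrigo, W. Sadowski, *The Three-Dimensional Navier–Stokes Equations*, CUP 2016, Ch. 8
  (proof of Lemma 8.4: good restarting times). [RobinsonRodrigoSadowski2016]
* J. T. Beale, T. Kato, A. Majda, Comm. Math. Phys. 94 (1984) 61–66, §1 (maximal smooth solutions, time
  translation). [BealeKatoMajda1984]
-/

noncomputable section

open MeasureTheory Set Function Filter Topology TemperedDistribution
open scoped ENNReal NNReal SchwartzMap
open Literature.Analysis.FluidPDE Literature.Analysis.FunctionSpaces
open Summit.NavierStokesRegularity.FluidComputer.LevelReynoldsFloor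

namespace Summit.NavierStokesRegularity.FluidComputer.TerminalWindowFloor

/-- **The restart package.** Let `(u, p)` be a maximal smooth solution of the unforced Navier–Stokes system
on `ℝ³ × [0, T)` (`ν > 0`) which is Leray–Hopf from `u 0`, with slice distributions `U t`, `t ∈ [0, T]`. For every
`t₀ ∈ [0, T)` there is a restarting time `s ∈ (t₀, T)` such that the translate `(u(· + s), p(· + s))` is a maximal
smooth solution with lifespan `T - s` (`IsMaximalSmoothSolution.translate_zero`, Beale–Kato–Majda 1984 §1), is a
Leray–Hopf weak solution on `[0, T - s)` from its own datum (a good restarting time exists in every interval: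
`IsLerayHopfOn.exists_isLerayHopfOn_restart_Ioo`, Robinson–Rodrigo–Sadowski 2016, proof of Lemma 8.4), and has the
translated slice distributions `U (t + s)`. [cite: RobinsonRodrigoSadowski2016, Ch. 8 p. 121 (proof of Lemma 8.4)] -/
theorem exists_restart {ν T : ℝ} (hν : 0 < ν)
    {u : ℝ → EuclideanSpace ℝ (Fin 3) → EuclideanSpace ℝ (Fin 3)} {p : ℝ → EuclideanSpace ℝ (Fin 3) → ℝ}
    {U : ℝ → 𝓢'(EuclideanSpace ℝ (Fin 3), EuclideanSpace ℂ (Fin 3))}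
    (hmax : IsMaximalSmoothSolution ν 0 u p T) (hLH : IsLerayHopfOn T ν 0 (u 0) u)
    (hU : ∀ t ∈ Icc 0 T, IsDistributionOf (u t) (U t)) {t₀ : ℝ} (ht₀ : t₀ ∈ Ico 0 T) :
    ∃ s ∈ Ioo t₀ T,
      IsMaximalSmoothSolution ν 0 (fun t => u (t + s)) (fun t => p (t + s)) (T - s) ∧
      IsLerayHopfOn (T - s) ν 0 ((fun t => u (t + s)) 0) (fun t => u (t + s)) ∧
      (∀ t ∈ Icc 0 (T - s), IsDistributionOf ((fun t => u (t + s)) t) ((fun t => U (t + s)) t)) := by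
  obtain ⟨s, hs, hLHs⟩ := hLH.exists_isLerayHopfOn_restart_Ioo hν.le ht₀.1 ht₀.2 le_rfl
  refine ⟨s, hs, hmax.translate_zero (ht₀.1.trans_lt hs.1) hs.2, by simpa only [zero_add] using hLHs,
    fun t ht => hU (t + s) ⟨?_, ?_⟩⟩
  · linarith [ht.1, hs.1, ht₀.1]
  · linarith [ht.2]

/-- Monotonicity of the window supremum under the restart: for `s > t₀`, the supremum of any level functional
over the translate's life span `(0, T - s)` is at most its supremum over the window `(t₀, T)`. [folklore] -/
theorem iSup_translate_le {T s t₀ : ℝ} (hs : t₀ < s) (F : ℝ → ℝ≥0∞) :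
    (⨆ t ∈ Ioo 0 (T - s), F (t + s)) ≤ ⨆ t ∈ Ioo t₀ T, F t :=
  iSup₂_le fun t ht => le_iSup₂_of_le (t + s) ⟨by linarith [ht.1], by linarith [ht.2]⟩ le_rfl

/-- **L5 — the level-Reynolds floor holds in every terminal window.** There is an absolute `c > 0` (the
constant of `LevelReynoldsFloor.dyadic_floor`, i.e. of Cheskidov–Shvydkoy 2010, Lemma 3.2) such that for every
`ν > 0`, `T > 0`, every maximal smooth solution `(u, p)` of the unforced Navier–Stokes system on `ℝ³ × [0, T)` which
is Leray–Hopf from `u 0`, slice distributions `U t`, and EVERY `t₀ ∈ [0, T)`: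
`c ν ≤ limsup_{j → ∞} sup_{t ∈ (t₀, T)} 2^{-j} ‖Δ̇_j U(t)‖_∞`. Proof: restart at a good time `s ∈ (t₀, T)`
(`exists_restart`), apply `dyadic_floor` to the translate, and enlarge the window `(s, T) ⊆ (t₀, T)`. A single
early saturation event cannot carry a blow-up: the floor must be met again after any `t₀ < T`.
[cite: CheskidovShvydkoy2010, Lemma 3.2] -/
theorem dyadic_floor_window :
    ∃ c : ℝ, 0 < c ∧ ∀ (ν T : ℝ), 0 < ν → 0 < T →
      ∀ (u : ℝ → EuclideanSpace ℝ (Fin 3) → EuclideanSpace ℝ (Fin 3)) (p : ℝ → EuclideanSpace ℝ (Fin 3) → ℝ)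
        (U : ℝ → 𝓢'(EuclideanSpace ℝ (Fin 3), EuclideanSpace ℂ (Fin 3))),
      IsMaximalSmoothSolution ν 0 u p T → IsLerayHopfOn T ν 0 (u 0) u →
      (∀ t ∈ Icc 0 T, IsDistributionOf (u t) (U t)) →
      ∀ t₀ ∈ Ico 0 T, ENNReal.ofReal (c * ν) ≤
        limsup (fun j : ℕ => ⨆ t ∈ Ioo t₀ T, lpBlockWeight (-1) ∞ (U t) (j : ℤ)) atTop := by
  obtain ⟨c, hc, H⟩ := dyadic_floor
  refine ⟨c, hc, fun ν T hν hT u p U hmax hLH hU t₀ ht₀ => ?_⟩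
  obtain ⟨s, hs, hmaxs, hLHs, hUs⟩ := exists_restart hν hmax hLH hU ht₀
  have key := H ν (T - s) hν (sub_pos.2 hs.2) (fun t => u (t + s)) (fun t => p (t + s)) (fun t => U (t + s))
    hmaxs hLHs hUs
  exact key.trans (limsup_le_limsup (Eventually.of_forall fun j =>
    iSup_translate_le hs.1 (fun t => lpBlockWeight (-1) ∞ (U t) (j : ℤ))))

/-- **L5′ — infinitely many levels beat viscosity inside every terminal window (weight form).** With the constant
`c` of `dyadic_floor_window`: for every maximal smooth solution as there, every `t₀ ∈ [0, T)` and every `b < c`,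
there are infinitely many dyadic levels `j` with `sup_{t ∈ (t₀,T)} 2^{-j}‖Δ̇_j U(t)‖_∞ > b ν` — the window version
of `LevelReynoldsFloor.level_amplitude_frequently_gt`. [cite: CheskidovShvydkoy2010, Lemma 3.2] -/
theorem level_amplitude_frequently_gt_window :
    ∃ c : ℝ, 0 < c ∧ ∀ (ν T : ℝ), 0 < ν → 0 < T →
      ∀ (u : ℝ → EuclideanSpace ℝ (Fin 3) → EuclideanSpace ℝ (Fin 3)) (p : ℝ → EuclideanSpace ℝ (Fin 3) → ℝ)
        (U : ℝ → 𝓢'(EuclideanSpace ℝ (Fin 3), EuclideanSpace ℂ (Fin 3))),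
      IsMaximalSmoothSolution ν 0 u p T → IsLerayHopfOn T ν 0 (u 0) u →
      (∀ t ∈ Icc 0 T, IsDistributionOf (u t) (U t)) →
      ∀ t₀ ∈ Ico 0 T, ∀ b : ℝ, b < c →
        ∃ᶠ j : ℕ in atTop, ENNReal.ofReal (b * ν) < ⨆ t ∈ Ioo t₀ T, lpBlockWeight (-1) ∞ (U t) (j : ℤ) := by
  obtain ⟨c, hc, H⟩ := dyadic_floor_window
  refine ⟨c, hc, fun ν T hν hT u p U hmax hLH hU t₀ ht₀ b hb => ?_⟩
  have hfloor := H ν T hν hT u p U hmax hLH hU t₀ ht₀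
  have hbν : ENNReal.ofReal (b * ν) < ENNReal.ofReal (c * ν) :=
    (ENNReal.ofReal_lt_ofReal_iff (mul_pos hc hν)).2 (mul_lt_mul_of_pos_right hb hν)
  exact frequently_lt_of_lt_limsup (by isBoundedDefault) (hbν.trans_le hfloor)

/-- **L5′ (amplitude form) — `sup_{t ∈ (t₀,T)} ‖Δ̇_j U(t)‖_∞ > b ν 2^j` at infinitely many levels, in every terminal
window.** The window version of `LevelReynoldsFloor.level_supnorm_frequently_gt`, obtained by applying that theorem
to the restarted solution of `exists_restart`: for every `t₀ ∈ [0, T)` and `b < c`, infinitely many levels `j`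
(wavenumber `k_j = 2^j`) have window amplitude `sup_{t ∈ (t₀,T)} ‖Δ̇_j U(t)‖_{L^∞} > b ν k_j` (level Reynolds number
above `b` AFTER `t₀`). [cite: CheskidovShvydkoy2010, Lemma 3.2] -/
theorem level_supnorm_frequently_gt_window :
    ∃ c : ℝ, 0 < c ∧ ∀ (ν T : ℝ), 0 < ν → 0 < T →
      ∀ (u : ℝ → EuclideanSpace ℝ (Fin 3) → EuclideanSpace ℝ (Fin 3)) (p : ℝ → EuclideanSpace ℝ (Fin 3) → ℝ)
        (U : ℝ → 𝓢'(EuclideanSpace ℝ (Fin 3), EuclideanSpace ℂ (Fin 3))),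
      IsMaximalSmoothSolution ν 0 u p T → IsLerayHopfOn T ν 0 (u 0) u →
      (∀ t ∈ Icc 0 T, IsDistributionOf (u t) (U t)) →
      ∀ t₀ ∈ Ico 0 T, ∀ b : ℝ, b < c →
        ∃ᶠ j : ℕ in atTop, ENNReal.ofReal (b * ν) * (2 : ℝ≥0∞) ^ j <
          ⨆ t ∈ Ioo t₀ T, eLpNormDistrib ∞ (lpBlock (j : ℤ) (U t)) := by
  obtain ⟨c, hc, H⟩ := level_supnorm_frequently_gt
  refine ⟨c, hc, fun ν T hν hT u p U hmax hLH hU t₀ ht₀ b hb => ?_⟩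
  obtain ⟨s, hs, hmaxs, hLHs, hUs⟩ := exists_restart hν hmax hLH hU ht₀
  have key := H ν (T - s) hν (sub_pos.2 hs.2) (fun t => u (t + s)) (fun t => p (t + s)) (fun t => U (t + s))
    hmaxs hLHs hUs b hb
  exact key.mono fun j hj =>
    hj.trans_le (iSup_translate_le hs.1 (fun t => eLpNormDistrib ∞ (lpBlock (j : ℤ) (U t))))

/-- **L6 — NO ONE-SHOT FOCUSING: saturation recurs at arbitrarily high levels, arbitrarily late.** With the constant
`c` of `dyadic_floor_window`: for every maximal smooth solution `(u, p)` (lifespan `T`, Leray–Hopf from `u 0`, slice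
distributions `U t`), every `t₀ ∈ [0, T)`, every `b < c` and every `J : ℕ`, there are a level `j ≥ J` and a time
`t ∈ (t₀, T)` at which level `j` is SATURATED in the sense of Cheskidov–Shvydkoy 2014 §3,
`IsSaturatedLevel b ν (u t) j` : `b ν 2^j ≤ ‖Δ̇_j u(t)‖_{L^∞}` (level Reynolds number `≥ b`). Proof: L5′ gives a
level `j ≥ J` with `b ν < sup_{t ∈ (t₀,T)} 2^{-j}‖Δ̇_j U(t)‖_∞`, hence a time in the window, and the dictionary
`isSaturatedLevel_iff_le_lpBlockWeight` (slices are in `L²` by the Leray–Hopf property).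
[cite: CheskidovShvydkoy2011, §3 (definition of Λ)] -/
theorem exists_saturated_after :
    ∃ c : ℝ, 0 < c ∧ ∀ (ν T : ℝ), 0 < ν → 0 < T →
      ∀ (u : ℝ → EuclideanSpace ℝ (Fin 3) → EuclideanSpace ℝ (Fin 3)) (p : ℝ → EuclideanSpace ℝ (Fin 3) → ℝ)
        (U : ℝ → 𝓢'(EuclideanSpace ℝ (Fin 3), EuclideanSpace ℂ (Fin 3))),
      IsMaximalSmoothSolution ν 0 u p T → IsLerayHopfOn T ν 0 (u 0) u →
      (∀ t ∈ Icc 0 T, IsDistributionOf (u t) (U t)) →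
      ∀ t₀ ∈ Ico 0 T, ∀ b : ℝ, b < c → ∀ J : ℕ,
        ∃ j : ℕ, J ≤ j ∧ ∃ t ∈ Ioo t₀ T, IsSaturatedLevel b ν (u t) j := by
  obtain ⟨c, hc, H⟩ := level_amplitude_frequently_gt_window
  refine ⟨c, hc, fun ν T hν hT u p U hmax hLH hU t₀ ht₀ b hb J => ?_⟩
  have hfreq := H ν T hν hT u p U hmax hLH hU t₀ ht₀ b hb
  obtain ⟨j, hj, hJj⟩ := (hfreq.and_eventually (eventually_ge_atTop J)).exists
  obtain ⟨t, ht⟩ := lt_iSup_iff.1 hj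
  obtain ⟨htI, hlt⟩ := lt_iSup_iff.1 ht
  have htc : t ∈ Icc 0 T := ⟨ht₀.1.trans htI.1.le, htI.2.le⟩
  exact ⟨j, hJj, t, htI,
    (isSaturatedLevel_iff_le_lpBlockWeight (hU t htc) (hLH.memLp t htc) b ν j).2 hlt.le⟩

/-- **L7 — the dissipation wavenumber is unbounded on every terminal window.** With the constant `c` of
`dyadic_floor_window`: for every maximal smooth solution `(u, p)` (lifespan `T`, Leray–Hopf from `u 0`, slice
distributions `U t`), every `t₀ ∈ [0, T)` and every threshold `b < c`,
`sup_{t ∈ (t₀, T)} Λ_b(u(t)) = ∞`, where `Λ_b = dissipationWavenumber b ν` is the Cheskidov–Shvydkoy dissipation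
wavenumber (top saturated dyadic wavenumber; "`Λ ∈ L^∞(0,T)`" is their restatement of the 2010 criterion, §4).
The window `(0, T)` is the contrapositive of the tree's `regular_of_dissipationWavenumber_le`; the point here is
EVERY window: `limsup_{t ↑ T} Λ_b(u(t)) = ∞`. [cite: CheskidovShvydkoy2011, §4] -/
theorem iSup_dissipationWavenumber_window_eq_top :
    ∃ c : ℝ, 0 < c ∧ ∀ (ν T : ℝ), 0 < ν → 0 < T →
      ∀ (u : ℝ → EuclideanSpace ℝ (Fin 3) → EuclideanSpace ℝ (Fin 3)) (p : ℝ → EuclideanSpace ℝ (Fin 3) → ℝ)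
        (U : ℝ → 𝓢'(EuclideanSpace ℝ (Fin 3), EuclideanSpace ℂ (Fin 3))),
      IsMaximalSmoothSolution ν 0 u p T → IsLerayHopfOn T ν 0 (u 0) u →
      (∀ t ∈ Icc 0 T, IsDistributionOf (u t) (U t)) →
      ∀ t₀ ∈ Ico 0 T, ∀ b : ℝ, b < c →
        (⨆ t ∈ Ioo t₀ T, dissipationWavenumber b ν (u t)) = ∞ := by
  obtain ⟨c, hc, H⟩ := exists_saturated_after
  refine ⟨c, hc, fun ν T hν hT u p U hmax hLH hU t₀ ht₀ b hb => ?_⟩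
  refine ENNReal.eq_top_of_forall_nnreal_le fun r => ?_
  obtain ⟨j, hJj, t, htI, hsat⟩ := H ν T hν hT u p U hmax hLH hU t₀ ht₀ b hb ⌈r⌉₊
  calc (r : ℝ≥0∞) ≤ ((⌈r⌉₊ : ℕ) : ℝ≥0∞) := by exact_mod_cast Nat.le_ceil r
    _ ≤ (j : ℝ≥0∞) := by exact_mod_cast hJj
    _ ≤ (2 : ℝ≥0∞) ^ j := by exact_mod_cast (Nat.lt_two_pow_self (n := j)).le
    _ ≤ dissipationWavenumber b ν (u t) := two_pow_le_dissipationWavenumber hsat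
    _ ≤ ⨆ t ∈ Ioo t₀ T, dissipationWavenumber b ν (u t) := le_iSup₂_of_le t htI le_rfl

/-- **L8 (a) — quiet high levels under `H¹` control.** The Bernstein step of Cheskidov–Shvydkoy 2014, Lemma 4.1
(tree: `exists_two_pow_mul_le_dissipation_of_saturated`, `(bν)² 2^j ≤ C ∫ |∇v|²` at a saturated level): there is
an absolute `C` such that an `L²` slice `v` with weak gradient `G`, `∫ |G|² < ∞`, has NO saturated level `j` with
`C ∫ |G|² < (b ν)² 2^j` — every level above `log₂ (C ∫|∇v|² / (bν)²)` is quiet.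
[cite: CheskidovShvydkoy2011, Lemma 4.1] -/
theorem not_isSaturatedLevel_of_lt :
    ∃ C : ℝ≥0, ∀ (b ν : ℝ) (j : ℕ) (v : EuclideanSpace ℝ (Fin 3) → EuclideanSpace ℝ (Fin 3))
      (G : EuclideanSpace ℝ (Fin 3) → EuclideanSpace ℝ (Fin 3) →L[ℝ] EuclideanSpace ℝ (Fin 3)),
      MemLp v 2 volume → HasWeakGradient v G →
      (∫⁻ x, ENNReal.ofReal (frobeniusNormSq (G x))) < ∞ →
      (C : ℝ≥0∞) * (∫⁻ x, ENNReal.ofReal (frobeniusNormSq (G x))) < ENNReal.ofReal (b * ν) ^ 2 * 2 ^ j →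
      ¬ IsSaturatedLevel b ν v j := by
  obtain ⟨C, hC⟩ := exists_two_pow_mul_le_dissipation_of_saturated
  exact ⟨C, fun b ν j v G hv hG hD hlt hsat => not_lt.2 (hC b ν j v G hv hG hD hsat) hlt⟩

/-- **L8 (b) — LADDER ORDER: the saturation front migrates to ever finer levels as `t ↑ T`.** With the absolute
constant `c > 0` of Cheskidov–Shvydkoy 2010, Lemma 3.2 (and, inside the proof, the Bernstein constant `C` of L8 (a)): for
every maximal smooth solution `(u, p)` of the unforced Navier–Stokes system on `ℝ³ × [0, T)` (`ν > 0`), Leray–Hopf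
from `u 0`, slice distributions `U t`, every `t₀ ∈ [0, T)` along which the dissipation is controlled —
weak gradients `G t` of the slices with `∫ |G t|² ≤ D < ∞` for all `t ∈ [0, t₀]` — every `b ∈ (0, c)` and every
`J`, there is a level `j ≥ J` which is QUIET THROUGHOUT `[0, t₀]` (`¬ IsSaturatedLevel b ν (u t) j` for all
`t ≤ t₀`) and SATURATED at some time `t ∈ (t₀, T)`. So a realised blow-up meets the level-Reynolds floor at
infinitely many levels in order of time — later windows need finer levels — and never through one focusing event
followed by decay (the cell's "ONE-SHOT FOCUSING" reading, RULING R34, is thereby a non-blow-up signature on the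
theorem side as well). Proof: L6 above level `max J j_D`, where `(bν)² 2^{j_D} > C D` (`ENNReal.exists_nat_mul_gt`),
and L8 (a) on `[0, t₀]`. [cite: CheskidovShvydkoy2011, Lemma 4.1] -/
theorem exists_quiet_then_saturated :
    ∃ c : ℝ, 0 < c ∧ ∀ (ν T : ℝ), 0 < ν → 0 < T →
      ∀ (u : ℝ → EuclideanSpace ℝ (Fin 3) → EuclideanSpace ℝ (Fin 3)) (p : ℝ → EuclideanSpace ℝ (Fin 3) → ℝ)
        (U : ℝ → 𝓢'(EuclideanSpace ℝ (Fin 3), EuclideanSpace ℂ (Fin 3))),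
      IsMaximalSmoothSolution ν 0 u p T → IsLerayHopfOn T ν 0 (u 0) u →
      (∀ t ∈ Icc 0 T, IsDistributionOf (u t) (U t)) →
      ∀ t₀ ∈ Ico 0 T,
      ∀ (G : ℝ → EuclideanSpace ℝ (Fin 3) → EuclideanSpace ℝ (Fin 3) →L[ℝ] EuclideanSpace ℝ (Fin 3)) (D : ℝ≥0∞),
      D < ∞ →
      (∀ t ∈ Icc 0 t₀, HasWeakGradient (u t) (G t) ∧ (∫⁻ x, ENNReal.ofReal (frobeniusNormSq (G t x))) ≤ D) →
      ∀ b : ℝ, 0 < b → b < c → ∀ J : ℕ,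
        ∃ j : ℕ, J ≤ j ∧ (∀ t ∈ Icc 0 t₀, ¬ IsSaturatedLevel b ν (u t) j) ∧
          ∃ t ∈ Ioo t₀ T, IsSaturatedLevel b ν (u t) j := by
  obtain ⟨c, hc, H⟩ := exists_saturated_after
  obtain ⟨C, hC⟩ := not_isSaturatedLevel_of_lt
  refine ⟨c, hc, fun ν T hν hT u p U hmax hLH hU t₀ ht₀ G D hD hG b hb hbc J => ?_⟩
  -- a level `j_D` above which `[0, t₀]` is quiet: `(bν)² 2^{j_D} > C D`
  have ha : ENNReal.ofReal (b * ν) ^ 2 ≠ 0 := pow_ne_zero _ (ENNReal.ofReal_pos.2 (mul_pos hb hν)).ne'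
  have hCD : (C : ℝ≥0∞) * D ≠ ∞ := ENNReal.mul_ne_top ENNReal.coe_ne_top hD.ne
  obtain ⟨n, hn⟩ := ENNReal.exists_nat_mul_gt ha hCD
  obtain ⟨j, hJj, t, htI, hsat⟩ := H ν T hν hT u p U hmax hLH hU t₀ ht₀ b hbc (max J n)
  refine ⟨j, (le_max_left J n).trans hJj, fun t' ht' => ?_, t, htI, hsat⟩
  have ht'T : t' ∈ Icc 0 T := ⟨ht'.1, ht'.2.trans ht₀.2.le⟩
  obtain ⟨hGt, hDt⟩ := hG t' ht'
  refine hC b ν j (u t') (G t') (hLH.memLp t' ht'T) hGt (hDt.trans_lt hD) ?_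
  -- `C ∫|G t'|² ≤ C D < n (bν)² ≤ 2^j (bν)²`
  have hnj : (n : ℝ≥0∞) ≤ (2 : ℝ≥0∞) ^ j :=
    calc (n : ℝ≥0∞) ≤ (j : ℝ≥0∞) := by exact_mod_cast (le_max_right J n).trans hJj
      _ ≤ (2 : ℝ≥0∞) ^ j := by exact_mod_cast (Nat.lt_two_pow_self (n := j)).le
  calc (C : ℝ≥0∞) * (∫⁻ x, ENNReal.ofReal (frobeniusNormSq (G t' x)))
      ≤ (C : ℝ≥0∞) * D := by gcongr
    _ < n * ENNReal.ofReal (b * ν) ^ 2 := hn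
    _ ≤ (2 : ℝ≥0∞) ^ j * ENNReal.ofReal (b * ν) ^ 2 := by gcongr
    _ = ENNReal.ofReal (b * ν) ^ 2 * 2 ^ j := mul_comm _ _

/-- `limsup` along a mapped filter is the `limsup` of the composite (unfolding `Filter.limsup u f = limsSup (map u f)`
and `Filter.map_map`). [folklore] -/
theorem limsup_map_eq_limsup_comp {α β γ : Type*} [ConditionallyCompleteLattice γ] (u : β → γ) (φ : α → β)
    (f : Filter α) : limsup u (map φ f) = limsup (u ∘ φ) f := by
  simp only [Filter.limsup, Filter.map_map]

/-- **L9 — the jump floor holds in every terminal window (abruptness recurs up to the blow-up time).** With the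
absolute constant `c > 0` of `LevelReynoldsFloor.besov_jump_floor` (Cheskidov–Shvydkoy 2010, Thm. 3.1: a blow-up needs
left jumps of size `c ν` in `B^{-1}_{∞,∞}`): for every maximal smooth solution `(u, p)` of the unforced Navier–Stokes
system on `ℝ³ × [0, T)` (`ν > 0`), Leray–Hopf from `u 0`, slice distributions `U t`, and EVERY `t₁ ∈ [0, T)`,
`c ν ≤ sup_{t ∈ (t₁, T]} limsup_{t₀ → t⁻} ‖U t − U t₀‖_{B^{-1}_{∞,∞}}` — the jumps cannot all happen early: restart at a
good time `s ∈ (t₁, T)` (`exists_restart`), apply `besov_jump_floor` to the translate, and carry `limsup` over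
`𝓝[<] t` through the translation `t ↦ t + s` (`Homeomorph.addRight`). [cite: CheskidovShvydkoy2010, Thm. 3.1] -/
theorem besov_jump_floor_window :
    ∃ c : ℝ, 0 < c ∧ ∀ (ν T : ℝ), 0 < ν → 0 < T →
      ∀ (u : ℝ → EuclideanSpace ℝ (Fin 3) → EuclideanSpace ℝ (Fin 3)) (p : ℝ → EuclideanSpace ℝ (Fin 3) → ℝ)
        (U : ℝ → 𝓢'(EuclideanSpace ℝ (Fin 3), EuclideanSpace ℂ (Fin 3))),
      IsMaximalSmoothSolution ν 0 u p T → IsLerayHopfOn T ν 0 (u 0) u →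
      (∀ t ∈ Icc 0 T, IsDistributionOf (u t) (U t)) →
      ∀ t₁ ∈ Ico 0 T, ENNReal.ofReal (c * ν) ≤
        ⨆ t ∈ Ioc t₁ T, limsup (fun t₀ => eBesovNorm (-1) ∞ ∞ (U t - U t₀)) (𝓝[<] t) := by
  obtain ⟨c, hc, H⟩ := besov_jump_floor
  refine ⟨c, hc, fun ν T hν hT u p U hmax hLH hU t₁ ht₁ => ?_⟩
  obtain ⟨s, hs, hmaxs, hLHs, hUs⟩ := exists_restart hν hmax hLH hU ht₁
  have key := H ν (T - s) hν (sub_pos.2 hs.2) (fun t => u (t + s)) (fun t => p (t + s)) (fun t => U (t + s))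
    hmaxs hLHs hUs
  refine key.trans (iSup₂_le fun t ht => ?_)
  -- translate the left-neighbourhood filter: `map (· + s) (𝓝[<] t) = 𝓝[<] (t + s)`
  have hmap : map (fun x => x + s) (𝓝[<] t) = 𝓝[<] (t + s) := by
    have h := (Homeomorph.addRight s).isEmbedding.map_nhdsWithin_eq (Iio t) t
    simpa only [Homeomorph.coe_addRight, Set.image_add_const_Iio] using h
  have heq : limsup (fun t₀ => eBesovNorm (-1) ∞ ∞ (U (t + s) - U (t₀ + s))) (𝓝[<] t) =
      limsup (fun t' => eBesovNorm (-1) ∞ ∞ (U (t + s) - U t')) (𝓝[<] (t + s)) := by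
    rw [← hmap, limsup_map_eq_limsup_comp]
    rfl
  calc limsup (fun t₀ => eBesovNorm (-1) ∞ ∞ (U (t + s) - U (t₀ + s))) (𝓝[<] t)
      = limsup (fun t' => eBesovNorm (-1) ∞ ∞ (U (t + s) - U t')) (𝓝[<] (t + s)) := heq
    _ ≤ ⨆ t ∈ Ioc t₁ T, limsup (fun t₀ => eBesovNorm (-1) ∞ ∞ (U t - U t₀)) (𝓝[<] t) :=
        le_iSup₂_of_le (t + s) ⟨by linarith [ht.1, hs.1], by linarith [ht.2]⟩ le_rfl

/-! ## Hypothesis-minimal forms (the slice distributions always exist) and the `limsup_{t ↑ T}` form -/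

/-- **L6′ — NO ONE-SHOT FOCUSING, hypothesis-minimal form.** The slice distributions of a Leray–Hopf solution
always exist (`LambdaFrontier.exists_sliceDistribution`: the `L²` slices define tempered distributions), so L6 needs no
`U`: with the absolute `c > 0` of `dyadic_floor_window`, for every maximal smooth solution `(u, p)` of the unforced
Navier–Stokes system on `ℝ³ × [0, T)` (`ν > 0`) which is Leray–Hopf from `u 0`, every `t₀ ∈ [0, T)`, every `b < c` and
every `J`, some level `j ≥ J` is saturated (`‖Δ̇_j u(t)‖_∞ ≥ b ν 2^j`) at some time `t ∈ (t₀, T)`.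
[cite: CheskidovShvydkoy2010, Lemma 3.2] -/
theorem exists_saturated_after' :
    ∃ c : ℝ, 0 < c ∧ ∀ (ν T : ℝ), 0 < ν → 0 < T →
      ∀ (u : ℝ → EuclideanSpace ℝ (Fin 3) → EuclideanSpace ℝ (Fin 3)) (p : ℝ → EuclideanSpace ℝ (Fin 3) → ℝ),
      IsMaximalSmoothSolution ν 0 u p T → IsLerayHopfOn T ν 0 (u 0) u →
      ∀ t₀ ∈ Ico 0 T, ∀ b : ℝ, b < c → ∀ J : ℕ,
        ∃ j : ℕ, J ≤ j ∧ ∃ t ∈ Ioo t₀ T, IsSaturatedLevel b ν (u t) j := by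
  obtain ⟨c, hc, H⟩ := exists_saturated_after
  refine ⟨c, hc, fun ν T hν hT u p hmax hLH t₀ ht₀ b hb J => ?_⟩
  obtain ⟨U, hU⟩ := LambdaFrontier.exists_sliceDistribution hLH
  exact H ν T hν hT u p U hmax hLH hU t₀ ht₀ b hb J

/-- **L7′ — `Λ` unbounded on every terminal window, hypothesis-minimal form** (strengthens the tree's
`LambdaFrontier.iSup_dissipationWavenumber_eq_top`, which is the window `(0, T)`): for every maximal smooth solution
`(u, p)` as above, every `t₀ ∈ [0, T)` and every threshold `b < c`, `sup_{t ∈ (t₀, T)} Λ_b(u(t)) = ∞`.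
[cite: CheskidovShvydkoy2011, §4] -/
theorem iSup_dissipationWavenumber_window_eq_top' :
    ∃ c : ℝ, 0 < c ∧ ∀ (ν T : ℝ), 0 < ν → 0 < T →
      ∀ (u : ℝ → EuclideanSpace ℝ (Fin 3) → EuclideanSpace ℝ (Fin 3)) (p : ℝ → EuclideanSpace ℝ (Fin 3) → ℝ),
      IsMaximalSmoothSolution ν 0 u p T → IsLerayHopfOn T ν 0 (u 0) u →
      ∀ t₀ ∈ Ico 0 T, ∀ b : ℝ, b < c →
        (⨆ t ∈ Ioo t₀ T, dissipationWavenumber b ν (u t)) = ∞ := by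
  obtain ⟨c, hc, H⟩ := iSup_dissipationWavenumber_window_eq_top
  refine ⟨c, hc, fun ν T hν hT u p hmax hLH t₀ ht₀ b hb => ?_⟩
  obtain ⟨U, hU⟩ := LambdaFrontier.exists_sliceDistribution hLH
  exact H ν T hν hT u p U hmax hLH hU t₀ ht₀ b hb

/-- **L7″ — `limsup_{t ↑ T} Λ_b(u(t)) = ∞`.** The left upper limit AT THE BLOW-UP TIME of the Cheskidov–Shvydkoy
dissipation wavenumber is infinite: there is an absolute `c > 0` such that for every `ν > 0`, `T > 0`, every maximal
smooth solution `(u, p)` of the unforced Navier–Stokes system on `ℝ³ × [0, T)` which is Leray–Hopf from `u 0`, and every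
threshold `b < c`, `limsup_{t → T⁻} Λ_b(u(t)) = ∞` (`Filter.limsup` along `𝓝[<] T`). Equivalently: saturated levels of
arbitrarily high index occur in every left neighbourhood of `T` — the dissipation range never settles before the
blow-up time. Proof: every set in `𝓝[<] T` contains a window `(t₀, T)` (`mem_nhdsLT_iff_exists_Ioo_subset`), in which
L6′ finds a saturated level `≥ n`, so `2^n ≤ Λ_b` frequently along `𝓝[<] T` for every `n`
(`Filter.le_limsup_of_frequently_le'`). [cite: CheskidovShvydkoy2011, §4] -/
theorem limsup_dissipationWavenumber_nhdsLT_eq_top :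
    ∃ c : ℝ, 0 < c ∧ ∀ (ν T : ℝ), 0 < ν → 0 < T →
      ∀ (u : ℝ → EuclideanSpace ℝ (Fin 3) → EuclideanSpace ℝ (Fin 3)) (p : ℝ → EuclideanSpace ℝ (Fin 3) → ℝ),
      IsMaximalSmoothSolution ν 0 u p T → IsLerayHopfOn T ν 0 (u 0) u →
      ∀ b : ℝ, b < c →
        limsup (fun t => dissipationWavenumber b ν (u t)) (𝓝[<] T) = ∞ := by
  obtain ⟨c, hc, H⟩ := exists_saturated_after'
  refine ⟨c, hc, fun ν T hν hT u p hmax hLH b hb => ?_⟩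
  -- `2^n ≤ Λ_b(u t)` frequently along `𝓝[<] T`, for every `n`
  have hfreq : ∀ n : ℕ, ∃ᶠ t in 𝓝[<] T, (2 : ℝ≥0∞) ^ n ≤ dissipationWavenumber b ν (u t) := by
    intro n
    refine Filter.frequently_iff.2 fun {s} hs => ?_
    obtain ⟨l, hl, hls⟩ := mem_nhdsLT_iff_exists_Ioo_subset.1 hs
    -- work in the window `(max l 0, T)`
    have ht₀ : max l 0 ∈ Ico 0 T := ⟨le_max_right l 0, max_lt hl hT⟩
    obtain ⟨j, hnj, t, htI, hsat⟩ := H ν T hν hT u p hmax hLH (max l 0) ht₀ b hb n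
    refine ⟨t, hls ⟨(le_max_left l 0).trans_lt htI.1, htI.2⟩, ?_⟩
    calc (2 : ℝ≥0∞) ^ n ≤ 2 ^ j := pow_le_pow_right₀ one_le_two hnj
      _ ≤ dissipationWavenumber b ν (u t) := two_pow_le_dissipationWavenumber hsat
  refine ENNReal.eq_top_of_forall_nnreal_le fun r => ?_
  calc (r : ℝ≥0∞) ≤ ((⌈r⌉₊ : ℕ) : ℝ≥0∞) := by exact_mod_cast Nat.le_ceil r
    _ ≤ (2 : ℝ≥0∞) ^ ⌈r⌉₊ := by exact_mod_cast (Nat.lt_two_pow_self (n := ⌈r⌉₊)).le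
    _ ≤ limsup (fun t => dissipationWavenumber b ν (u t)) (𝓝[<] T) := le_limsup_of_frequently_le' (hfreq _)

end Summit.NavierStokesRegularity.FluidComputer.TerminalWindowFloor

end
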